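import Summits.ABC.IUTFork.Cor312TeamAGapWitnessB
import HarnessLib

/-!
# TEAM A gap witness, CONTENTFUL grade: non-degenerate Thm 3.11 instance, Cor 3.12 still fails

Record-only file (D-0012) of the abc-iut cell (Cor. 3.12 STRATEGY TEAM A «direct III§3», D-0067, seat
abc-iut-c312-9 = A1, row A-4); TAKES NO SIDE. Upgrade of `Cor312TeamAGapWitness(B)` answering w4-d041's
SPEC COMMENT (INBOX 00:17:04Z, «grade the DEGENERACY of the countermodel's Thm 3.11 instance»): in the
original witness every clause of the typed Theorem 3.11 held for a DEGENERATE reason (empty splitting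
monoids, identity column transport, whole-packet shell). THIS witness keeps the same separating geometry
on the same nontrivial `ℚ`-line packets (`gapVol`, hull frame `{{0}, univ}`, Θ-glue `{0}`, `q`-glue
everything — the glue fields the typed Thm 3.11 does not constrain) while making the Thm 3.11 instance
CONTENTFUL in each of the three graded respects:

* **nonempty splitting monoids**: `nvData.Ψ v hv = {0}` with `PsiInSubPackets` discharged by a genuine
  membership (`Submodule.zero_mem` of the sub-packet), not by vacuity;
* **proper shell in (Ind3)**: `nvData.shellPk` is the `ℤ`-lattice of the `ℚ`-line (`nv_shellPk_proper`:
  it omits the point `(packetEquiv)⁻¹(1/2)`), and the (Ind3) containments `unitImage ⊆ shellPk` are real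
  containments in a PROPER subset, not `Set.subset_univ`;
* **non-identity Kummer transport**: the column's holomorphic volume reads regions through the NEGATION
  automorphism (`nvColumn.frobLogvol m A = gapVol (Neg.neg '' A)`), so Thm 3.11 (ii) (a) is a LEMMA
  (`gapVol_neg_image`), not `rfl`; the object-level Kummer isomorphisms are non-identity between distinct
  carriers (`kumLGP` = Boolean negation, `kumLgp : Fin 2 ≃ Bool`; `nvColumn_kumLGP_true`).

`nvFull_statement` proves the typed Theorem 3.11 (i) ∧ (ii) ∧ (iii) IN FULL for this instance;
`nvSetting_bridgeHyps`/`nvSetting_absLogQPos`/`nvSetting_not_statement` re-run the part-B computation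
(`−|log(Θ)| = −2 < −1 = −|log(q)|`); `thm311_bridgeHyps_not_imp_statement_contentful` packages the
∃-form WITH the non-degeneracy clauses, for the §4 (iii) grading: the witness of record for (G3) is now
STRONG-CONTENTFUL in the three graded respects (the link data remains the discrete toy — said here, not
hidden; the glue fields remain free, which is the finding). HONEST SCOPE unchanged from part A: an
interface-level result about OUR typing; nothing about the intended instantiation. [claim: Mochizuki2012,
status: disputed] Deliberately NOT here: any judgement on (xi-f).
-/

noncomputable section

namespace Summit.ABC

namespace IUTFork

namespace Cor312Vol

namespace GapWitnessNV

open Thm311 Cor312 Cor312.Checks Cor312Vol.GapWitness Literature.IUT.LogThetaLattice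

/-! ## 1. The proper shell: the `ℤ`-lattice of the `ℚ`-line -/

/-- The `ℤ`-lattice of the packet `ℚ`-line: the preimage of `ℤ ⊆ ℚ` under the packet trivialisation.
[folklore] -/
def zShell (j : toyIndex.Label) (vQ : toyIndex.VQ) : Set (toyShells.Packet j vQ) :=
  (packetEquiv j vQ).symm '' (Set.range (Int.cast : ℤ → ℚ))

/-- `0` lies in the `ℤ`-lattice. [folklore] -/
theorem zero_mem_zShell (j : toyIndex.Label) (vQ : toyIndex.VQ) : 0 ∈ zShell j vQ :=
  ⟨(0 : ℚ), ⟨0, by norm_num⟩, by simp⟩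

/-- **The shell is PROPER**: the point `(packetEquiv)⁻¹(1/2)` of the packet is not in the `ℤ`-lattice.
[folklore] -/
theorem zShell_ne_univ (j : toyIndex.Label) (vQ : toyIndex.VQ) :
    zShell j vQ ≠ Set.univ := by
  intro h
  have hx : (packetEquiv j vQ).symm ((1 : ℚ) / 2) ∈ zShell j vQ := h ▸ Set.mem_univ _
  obtain ⟨q, ⟨n, rfl⟩, hq⟩ := hx
  have hq' : (n : ℚ) = 1 / 2 := (packetEquiv j vQ).symm.injective hq
  have h2 : ((2 * n : ℤ) : ℚ) = 1 := by push_cast; linarith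
  have h3 : (2 * n : ℤ) = 1 := by exact_mod_cast h2
  omega

/-! ## 2. The data: `gapVol` separating geometry, nonempty `Ψ`, proper shell -/

/-- Data (a)(b)(c) of the contentful witness: the separating monotone log-volume `gapVol` of part A; the
splitting monoid `{0}` (NONEMPTY, inside the sub-packets by a genuine membership); the PROPER shell
`zShell`. [folklore] -/
def nvData : MRData toyShells where
  shellPk := fun j vQ => zShell j vQ
  shellSub := fun _ _ => Set.univ
  Adm := fun _ _ _ => True
  logvol := fun j vQ A => gapVol j vQ A
  Ψ := fun _ _ => {0}
  act := fun _ _ _ => 0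
  Mmod := fun _ => {0}

/-- One Frobenioid object of degree `−1` whose region is everything (degree clause over `gapVol`).
[folklore] -/
def nvDegrees (j : toyIndex.LabelStar) : GlobalDegrees toyShells j where
  ObjMOD := Unit
  Objmod := Unit
  natIso := Equiv.refl Unit
  deg := fun _ => -1
  region := fun _ _ => Set.univ

/-- The contentful situation: the same data on every vertical line. [folklore] -/
def nvSituation : Situation toyIndex where
  L := toyShells
  D := fun _ => nvData
  G := fun _ j => nvDegrees j

/-! ## 3. The column: non-identity Kummer transport -/

/-- `gapVol` is invariant under reading a region through the negation automorphism (negation is a linear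
automorphism fixing `0`, so `(−1)·A ⊆ {0} ↔ A ⊆ {0}`): the Thm 3.11 (ii) (a) volume compatibility of the
contentful column is a LEMMA, not `rfl`. [folklore] -/
theorem gapVol_neg_image {j : toyIndex.Label} {vQ : toyIndex.VQ}
    (A : Set (toyShells.Packet j vQ)) : gapVol j vQ ((fun x => -x) '' A) = gapVol j vQ A := by
  by_cases hA : A ⊆ {0}
  · rw [gapVol_of_subset hA, gapVol_of_subset ?_]
    rintro y ⟨x, hx, rfl⟩
    have hx0 : x = 0 := hA hx
    simp [hx0]
  · rw [gapVol_of_not_subset hA, gapVol_of_not_subset ?_]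
    intro h
    refine hA fun x hx => ?_
    have hmem : -x ∈ (fun x => -x) '' A := ⟨x, hx, rfl⟩
    have h0 : -x ∈ ({0} : Set (toyShells.Packet j vQ)) := h hmem
    have : -x = 0 := h0
    simpa using congrArg Neg.neg this

/-- The Boolean negation as an equivalence (the non-identity object-level Kummer isomorphism). [folklore] -/
def boolNot : Bool ≃ Bool := ⟨Bool.not, Bool.not, Bool.not_not, Bool.not_not⟩

/-- A column with NON-IDENTITY Kummer transport: the holomorphic volume reads regions through negation
(`frobLogvol m A := gapVol ((−1)·A)`), the object-level isomorphisms are Boolean negation resp. the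
`Fin 2 ≃ Bool` identification of DISTINCT carriers; the unit images are the PROPER shell. [folklore] -/
def nvColumn : Column toyShells where
  frobAdm := fun _ _ _ _ => True
  frobLogvol := fun _ j vQ A => gapVol j vQ ((fun x => -x) '' A)
  frobΨ := fun _ _ _ => {0}
  frobMmod := fun _ _ => {0}
  unitImage := fun _ _ j vQ => zShell j vQ
  ballImage := fun _ j vQ => zShell j vQ
  ObjLGP := Bool
  frobObjLGP := fun _ => Bool
  kumLGP := fun _ => boolNot
  ObjLgp := Bool
  frobObjLgp := fun _ => Fin 2
  kumLgp := fun _ => finTwoEquiv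
  thetaPilot := fun _ => true

/-- The object-level Kummer isomorphism is NOT the identity: it swaps the two objects. [folklore] -/
theorem nvColumn_kumLGP_true : (nvColumn.kumLGP 0) true = false := rfl

/-- The full contentful situation (link data = the discrete toy link of part A, said openly in the module
docstring). [folklore] -/
def nvFull : FullSituation toyIndex where
  toSituation := nvSituation
  col := fun _ => nvColumn
  link := gapLink

/-! ## 4. The typed Theorem 3.11 holds, clause by clause, for contentful reasons -/

/-- (i) holds: the NONEMPTY splitting monoid sits in the sub-packets by `Submodule.zero_mem`; the degree
clause reads `−1 = −1` over the separating volume; the classes coincide. [folklore] -/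
theorem nv_partI : nvFull.PartI := by
  refine ⟨fun n v hv x hx j => ?_, fun n j J => ⟨fun _ => trivial, ?_, ?_⟩, fun n n' => rfl⟩
  · have hx0 : x = 0 := hx
    subst hx0
    simp
  · haveI : Finite toyIndex.VQ := inferInstanceAs (Finite Unit)
    exact Set.toFinite _
  · show (-1 : ℝ) = ∑ᶠ vQ : toyIndex.VQ, nvData.logvol j.1 vQ Set.univ
    have h : ∀ vQ : toyIndex.VQ, nvData.logvol j.1 vQ Set.univ = -1 := fun vQ =>
      gapVol_of_not_subset (univ_not_subset_zero j.1 vQ)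
    simp only [h]
    rw [finsum_unique]

/-- (ii) holds, column by column: (a) by the NEGATION-invariance lemma (not `rfl`), (b)/(c) as equalities
of NONEMPTY sets, (Ind3) as real containments in the PROPER shell. [folklore] -/
theorem nv_partII : nvFull.toLatticeSituation.PartII := by
  intro n
  refine (Column.partII_iff _ _).2 ⟨?_, fun _ _ _ => rfl, fun _ _ => rfl, ?_⟩
  · intro m j vQ A _
    exact ⟨trivial, gapVol_neg_image A⟩
  · exact ⟨fun m m' j vQ _ => subset_rfl, fun m j vQ h => absurd trivial h⟩

/-- (iii) holds (link data as in part A). [folklore] -/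
theorem nv_partIII : nvFull.PartIII := by
  refine ⟨gapLink.partIIIa_holds, gapLink.partIIIb_holds, ?_, ?_,
    nvFull.evalCompatUpToInd_of_multiradialCompat nv_partI.2.2⟩
  · refine gapLink.partIIIc_of_full (fun _ => rfl) fun n m => ?_
    rintro p ⟨a, rfl⟩; rfl
  · intro n m; exact Thm311.PolyIsoCalc.stabilized_full _ _

/-- **The typed Theorem 3.11 (i) ∧ (ii) ∧ (iii) HOLDS in the contentful witness.** [folklore] -/
theorem nvFull_statement : nvFull.Statement := ⟨nv_partI, nv_partII, nv_partIII⟩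

/-! ## 5. The setting, its two quantities, the bridge hypotheses; the Corollary fails -/

/-- The SETTING of the contentful witness (same glue geometry as part A — the fields the typed Thm 3.11
does not constrain): Θ-glue `{0}` (nonempty), `q`-glue everything, hull frame `{{0}, univ}`. [folklore] -/
def nvSetting : Setting nvSituation where
  n := 0
  HT := ℤ × ℤ
  LogLink := fun _ _ => Unit
  IsFull := fun _ => True
  lattice :=
    { theater := fun n m => (n, m)
      distinct := fun p q h => by simpa using h
      logLink := fun _ _ => ()
      logLink_full := fun _ _ => trivial }
  Frd := Unit
  IsoF := fun _ _ => Unit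
  Ob := fun _ => Unit
  realify := id
  Strip := Unit
  IsoS := fun _ _ => Unit
  M := fun _ _ => Unit
  sig := toySig
  split := { Msplit := fun _ _ => ⊤, exists_gen := fun _ _ => ⟨⟨(), trivial⟩, top_unit_isGenerator _⟩ }
  ObΔ := Unit
  N := fun _ _ => Unit
  qData := { q := fun _ _ => (), q_gen := fun _ _ => unit_isGenerator _, objOf := fun _ => () }
  frame := fun j vQ => gapFrame _
  hul_adm := fun _ _ _ _ => trivial
  thetaRegionOf := fun _ _ _ _ => {0}
  qRegionOf := fun _ _ _ => Set.univ
  qRegion_mem := fun _ _ => Set.mem_insert_of_mem _ rfl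
  qSupport_finite := fun _ => Set.toFinite _

/-- The (Ind3)-enlarged Θ-pilot region is `{0}` in every packet. [folklore] -/
theorem nv_thetaRegion3 (j : toyIndex.Label) (vQ : toyIndex.VQ) :
    nvSetting.thetaRegion3 j vQ = {0} := by
  show (⋃ _ : ℤ, ({0} : Set (toyShells.Packet j vQ))) = {0}
  exact Set.iUnion_const _

/-- The union of the possible images is `{0}` (linear indeterminacies fix `0`). [folklore] -/
theorem nv_sUnion_possibleImages (j : toyIndex.Label) (vQ : toyIndex.VQ) :
    ⋃₀ nvSetting.possibleImages j vQ = ({0} : Set (toyShells.Packet j vQ)) := by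
  ext x
  simp only [Set.mem_sUnion]
  constructor
  · rintro ⟨U, ⟨Φ, -, rfl⟩, hx⟩
    rw [nv_thetaRegion3, Set.image_singleton, map_zero] at hx
    exact hx
  · intro hx
    refine ⟨{0}, ?_, hx⟩
    exact nv_thetaRegion3 j vQ ▸ nvSetting.thetaRegion3_mem_possibleImages j vQ

/-- The packet hull is `{0}`; the local Θ-volume is `−2`; the local `q`-volume is `−1` (part-B
computation re-run over `nvSetting`). [folklore] -/
theorem nv_thetaLocal (j : toyIndex.Label) (vQ : toyIndex.VQ) :
    nvSetting.thetaLocal j vQ = ((-2 : ℝ) : WithTop ℝ) := by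
  have hHD : nvSetting.HullDefined j vQ := ⟨trivial, trivial⟩
  unfold Setting.thetaLocal
  rw [if_pos hHD]
  show ((nvData.logvol j vQ (nvSetting.thetaHull j vQ) : ℝ) : WithTop ℝ) = _
  have hhull : nvSetting.thetaHull j vQ = ({0} : Set (toyShells.Packet j vQ)) := by
    refine Set.Subset.antisymm ?_ ?_
    · show (gapFrame _).hull (⋃₀ nvSetting.possibleImages j vQ) ⊆ {0}
      exact gapFrame_hull_of_subset (nv_sUnion_possibleImages j vQ).le
    · exact ((nv_sUnion_possibleImages j vQ).symm.le).trans
        ((gapFrame (toyShells.Packet j vQ)).subset_hull (⋃₀ nvSetting.possibleImages j vQ))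
  rw [hhull]
  show ((gapVol j vQ ({0} : Set (toyShells.Packet j vQ)) : ℝ) : WithTop ℝ) = _
  rw [gapVol_of_subset subset_rfl]

/-- `−|log(Θ)| = −2` in the contentful witness. [folklore] -/
theorem nv_negLogTheta : nvSetting.negLogTheta = ((-2 : ℝ) : WithTop ℝ) := by
  have hfin : nvSetting.ThetaFinite :=
    ⟨fun i vQ => by rw [nv_thetaLocal]; exact WithTop.coe_ne_top, fun _ => Set.toFinite _⟩
  unfold Setting.negLogTheta
  rw [if_pos hfin]
  have h : ∀ i : Fin toyIndex.lstar,
      (∑ᶠ vQ : toyIndex.VQ, (nvSetting.thetaLocal (Setting.labelSucc i) vQ).untopD 0) = -2 := by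
    intro i
    have h1 : (fun vQ : toyIndex.VQ => (nvSetting.thetaLocal (Setting.labelSucc i) vQ).untopD 0) =
        fun _ => (-2 : ℝ) := by
      funext vQ
      rw [nv_thetaLocal, WithTop.untopD_coe]
    rw [h1, finsum_unique]
  simp only [h]
  exact congrArg _ (processionNormalized_const (by decide) (-2))

/-- `−|log(q)| = −1` in the contentful witness. [folklore] -/
theorem nv_negLogQ : nvSetting.negLogQ = -1 := by
  unfold Setting.negLogQ
  have h : ∀ i : Fin toyIndex.lstar,
      (∑ᶠ vQ : toyIndex.VQ, nvSetting.qLocal (Setting.labelSucc i) vQ) = -1 := by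
    intro i
    have h1 : (fun vQ : toyIndex.VQ => nvSetting.qLocal (Setting.labelSucc i) vQ) =
        fun _ => (-1 : ℝ) := by
      funext vQ
      exact gapVol_of_not_subset (univ_not_subset_zero _ vQ)
    rw [h1, finsum_unique]
  simp only [h]
  exact processionNormalized_const (by decide) (-1)

/-- All bridge hypotheses hold in the contentful witness. [folklore] -/
theorem nvSetting_bridgeHyps : BridgeHyps nvSetting where
  mono := fun i vQ A B _ _ hAB => gapData_logvol_mono hAB
  image_adm := fun _ _ _ _ => trivial
  image_fin := fun _ => Set.toFinite _
  hul_nonempty := fun j vQ H hH => by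
    rcases hH with rfl | rfl
    · exact ⟨0, rfl⟩
    · exact ⟨0, Set.mem_univ 0⟩
  theta_nonempty := fun i vQ => by
    rw [nv_thetaRegion3]
    exact ⟨0, rfl⟩
  finite := ⟨fun i vQ => by rw [nv_thetaLocal]; exact WithTop.coe_ne_top, fun _ => Set.toFinite _⟩

/-- `|log(q)| > 0` in the contentful witness. [folklore] -/
theorem nvSetting_absLogQPos : nvSetting.AbsLogQPos := by
  show nvSetting.negLogQ < 0
  rw [nv_negLogQ]; norm_num

/-- The typed Corollary 3.12 FAILS in the contentful witness. [folklore] -/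
theorem nvSetting_not_statement : ¬ nvSetting.Statement := by
  rintro ⟨-, hle⟩
  rw [nv_negLogQ, nv_negLogTheta, WithTop.coe_le_coe] at hle
  norm_num at hle

/-! ## 6. The isolation, CONTENTFUL grade -/

/-- **TEAM A GAP ISOLATION, STRONG-CONTENTFUL grade** (w4-d041's §4 (iii) grading): an instantiation in
which the typed Theorem 3.11 holds IN FULL with NONEMPTY splitting monoids (in the sub-packets by genuine
membership), a PROPER (Ind3) shell, and NON-identity Kummer transport — together with all bridge
hypotheses and `|log(q)| > 0` — while the typed Corollary 3.12 is FALSE. The free parameters remain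
exactly the two glue fields; the finding of part A stands at the higher grade. [folklore] -/
theorem thm311_bridgeHyps_not_imp_statement_contentful :
    ∃ (T : ThetaIndex) (F : FullSituation T) (P : Setting F.toLatticeSituation.toSituation),
      F.Statement ∧ BridgeHyps P ∧ P.AbsLogQPos ∧ ¬ P.Statement ∧
        (∀ (v : T.V) (hv : v ∈ T.Vbad), ((F.D 0).Ψ v hv).Nonempty) ∧
          ∀ (j : T.Label) (vQ : T.VQ), (F.D 0).shellPk j vQ ≠ Set.univ :=
  ⟨toyIndex, nvFull, nvSetting, nvFull_statement, nvSetting_bridgeHyps, nvSetting_absLogQPos,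
    nvSetting_not_statement, fun _ _ => ⟨0, rfl⟩, fun j vQ => zShell_ne_univ j vQ⟩

end GapWitnessNV

end Cor312Vol

end IUTFork

end Summit.ABC

end
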